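import Literature.NumberTheory.Sieve.DrappeauDispersionCruxTools
import Literature.NumberTheory.Sieve.DrappeauDispersionS1Phase
import HarnessLib

/-!
# Drappeau 2017, §5.5: the quintilinear sums `ℛ₁''` as "piece sums" (towards Theorem 2.1)

Topic `Literature/NumberTheory/Sieve`, part of the formalisation of §5 of S. Drappeau, Proc. London
Math. Soc. (3) 114 (2017) 684–732 = arXiv:1504.05549.  The hypothesis `HR1pp'` of the tree's
`Drappeau2017_theorem51_of_R1pp'` bounds the sums `ℛ₁''(ξ,λ₁,λ₂)` of (5.23).  To feed them to
Theorem 2.1 (≡ Assing–Blomer–Li 2021 Thm 2.3) they are first rewritten as `pieceSum`s: the weight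
`γ(q₀q₁)γ(q₀q₂)α(q₀q₁q₂ξ/M)` is isolated as a general two-variable weight `G(q₁,q₂)` (so that the
smooth dyadic splitting `γ(q₀·) = pieceLo + pieceHi` of `KloostermanQuintilinearDrappeauWeights`
and the Möbius inversion in `q_j` act by linearity), and the excluded frequencies `W ∣ h` are
recognised as `h = 0` (`W = q₀q₁q₂ > H`).  Everything proved; the only definition is `pieceSum`.

* `Drappeau2017.pieceSum` — the general piece sum;
* `pieceSum_add`, `pieceSum_congr_G` — linearity / dependence on `G` only through its values on `A₁ × A₂`;
* `sum_filter_coprime_eq_sum_moebius`, `sum_sum_filter_coprime_eq_sum_moebius` —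
  `∑_{q ∈ A, (q,a)=1} f = ∑_{δ∣a} μ(δ) ∑_{q ∈ A, δ∣q} f`;
* `pieceSum_filter_coprime_fst/snd` — Möbius inversion in `q₁` / `q₂`;
* `R1pp_eq_pieceSum` — `ℛ₁''(A₁,A₂) = pieceSum … G₀` with `G₀(q₁,q₂) = γ(q₀q₁)γ(q₀q₂)α(q₀q₁q₂ξ/M)`
  when `W = q₀q₁q₂ > H` on the support of `γ ⊗ γ`.

## References

* S. Drappeau, Proc. London Math. Soc. (3) 114 (2017) 684–732, arXiv:1504.05549, §5.5 (5.23) and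
  p. 20. [cite: Drappeau2017, §5.5]
-/

noncomputable section

open Finset Real Complex
open scoped ArithmeticFunction.Moebius FourierTransform

namespace Literature.NumberTheory.Sieve

namespace Drappeau2017

/-- **The piece sums.**  For finite sets of moduli `A₁, A₂`, of integers `B`, a two-variable weight
`G` and the data `(a₁,a₂,q₀,n₀,λ₁,λ₂,β,ξ,H)` of (5.23):
`pieceSum = ∑_{q₁∈A₁,q₂∈A₂} G(q₁,q₂) ∑_{n₁,n₂∈B} 1_{(q₁,q₂)=(n₁,n₂)=1} β(n₀n₁)β̄(n₀n₂)
   1_{(n₀n₁,q₀q₁)=(n₀n₂,q₀q₂)=1, n₁≡n₂ (q₀)} ∑_{0<|h|≤H} e(−ξh) e(a₁h·((n₁−n₂)/q₀)·\overline{q₁a₂n₀n₂}/(n₁q₂))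
   e(−a₁h·\overline{q₀λ₁λ₂n₁}/(a₂n₀))`. [cite: Drappeau2017, §5.5, (5.23)] -/
def pieceSum (a₁ a₂ : ℤ) (A₁ A₂ B : Finset ℕ) (q₀ n₀ l₁ l₂ : ℕ) (β : ℕ → ℂ) (ξ : ℝ)
    (G : ℕ → ℕ → ℂ) (H : ℕ) : ℂ :=
  ∑ q₁ ∈ A₁, ∑ q₂ ∈ A₂, G q₁ q₂ *
    ∑ n₁ ∈ B, ∑ n₂ ∈ B,
      (if (Nat.Coprime q₁ q₂ ∧ Nat.Coprime n₁ n₂) then (1 : ℂ) else 0) *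
        (β (n₀ * n₁) * starRingEnd ℂ (β (n₀ * n₂))) *
      (if ((n₀ * n₁).Coprime (q₀ * q₁) ∧ (n₀ * n₂).Coprime (q₀ * q₂) ∧ n₁ ≡ n₂ [MOD q₀]) then
          ∑ h ∈ (Finset.Icc (-(H : ℤ)) H).filter (fun h : ℤ => h ≠ 0),
            (𝐞 (-(ξ * h)) : ℂ) *
              ((𝐞 ((h : ℝ) * a₁ * ((((n₁ : ℤ) - n₂) / q₀ : ℤ)) *
                    ((((((q₁ : ℤ) * a₂ * n₀ * n₂ : ℤ) : ZMod (n₁ * q₂))⁻¹).val : ℕ) : ℝ) /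
                      ((n₁ : ℝ) * q₂)) : ℂ) *
                (𝐞 (-((h : ℝ) * a₁ *
                    ((((((q₀ : ℤ) * l₁ * l₂ * n₁ : ℤ) : ZMod (a₂.natAbs * n₀))⁻¹).val : ℕ) : ℝ) /
                      ((a₂ : ℝ) * n₀))) : ℂ))
        else 0)

/-- Linearity of `pieceSum` in the weight `G`. [folklore] -/
theorem pieceSum_add (a₁ a₂ : ℤ) (A₁ A₂ B : Finset ℕ) (q₀ n₀ l₁ l₂ : ℕ) (β : ℕ → ℂ) (ξ : ℝ)
    (G G' : ℕ → ℕ → ℂ) (H : ℕ) :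
    pieceSum a₁ a₂ A₁ A₂ B q₀ n₀ l₁ l₂ β ξ (fun q₁ q₂ => G q₁ q₂ + G' q₁ q₂) H =
      pieceSum a₁ a₂ A₁ A₂ B q₀ n₀ l₁ l₂ β ξ G H + pieceSum a₁ a₂ A₁ A₂ B q₀ n₀ l₁ l₂ β ξ G' H := by
  unfold pieceSum
  rw [← Finset.sum_add_distrib]
  refine Finset.sum_congr rfl fun q₁ _ => ?_
  rw [← Finset.sum_add_distrib]
  refine Finset.sum_congr rfl fun q₂ _ => ?_
  ring

/-- `pieceSum` only depends on the values of `G` on `A₁ × A₂`. [folklore] -/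
theorem pieceSum_congr_G (a₁ a₂ : ℤ) {A₁ A₂ : Finset ℕ} (B : Finset ℕ) (q₀ n₀ l₁ l₂ : ℕ) (β : ℕ → ℂ)
    (ξ : ℝ) {G G' : ℕ → ℕ → ℂ} (hG : ∀ q₁ ∈ A₁, ∀ q₂ ∈ A₂, G q₁ q₂ = G' q₁ q₂) (H : ℕ) :
    pieceSum a₁ a₂ A₁ A₂ B q₀ n₀ l₁ l₂ β ξ G H = pieceSum a₁ a₂ A₁ A₂ B q₀ n₀ l₁ l₂ β ξ G' H := by
  unfold pieceSum
  exact Finset.sum_congr rfl fun q₁ hq₁ => Finset.sum_congr rfl fun q₂ hq₂ => by rw [hG q₁ hq₁ q₂ hq₂]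

/-- Four-piece expansion: `G = G₁₁ + G₁₂ + G₂₁ + G₂₂` on `A₁ × A₂`. [folklore] -/
theorem pieceSum_eq_sum_four (a₁ a₂ : ℤ) {A₁ A₂ : Finset ℕ} (B : Finset ℕ) (q₀ n₀ l₁ l₂ : ℕ)
    (β : ℕ → ℂ) (ξ : ℝ) {G G₁₁ G₁₂ G₂₁ G₂₂ : ℕ → ℕ → ℂ}
    (hG : ∀ q₁ ∈ A₁, ∀ q₂ ∈ A₂, G q₁ q₂ = G₁₁ q₁ q₂ + G₁₂ q₁ q₂ + G₂₁ q₁ q₂ + G₂₂ q₁ q₂) (H : ℕ) :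
    pieceSum a₁ a₂ A₁ A₂ B q₀ n₀ l₁ l₂ β ξ G H =
      pieceSum a₁ a₂ A₁ A₂ B q₀ n₀ l₁ l₂ β ξ G₁₁ H + pieceSum a₁ a₂ A₁ A₂ B q₀ n₀ l₁ l₂ β ξ G₁₂ H +
      pieceSum a₁ a₂ A₁ A₂ B q₀ n₀ l₁ l₂ β ξ G₂₁ H + pieceSum a₁ a₂ A₁ A₂ B q₀ n₀ l₁ l₂ β ξ G₂₂ H := by
  rw [pieceSum_congr_G a₁ a₂ B q₀ n₀ l₁ l₂ β ξ hG H, pieceSum_add, pieceSum_add, pieceSum_add]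

/-! ### Möbius inversion in the moduli -/

/-- `∑_{q ∈ A, (q,a)=1} f(q) = ∑_{δ ∣ a} μ(δ) ∑_{q ∈ A, δ ∣ q} f(q)` (`a ≠ 0`).
[cite: Drappeau2017, §5.5 p. 20] -/
theorem sum_filter_coprime_eq_sum_moebius (A : Finset ℕ) {a : ℕ} (ha : a ≠ 0) (f : ℕ → ℂ) :
    ∑ q ∈ A.filter (fun q : ℕ => Nat.Coprime q a), f q =
      ∑ δ ∈ a.divisors, (ArithmeticFunction.moebius δ : ℂ) * ∑ q ∈ A.filter (fun q : ℕ => δ ∣ q), f q := by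
  rw [Finset.sum_filter]
  simp_rw [Finset.sum_filter, Finset.mul_sum]
  rw [Finset.sum_comm]
  refine Finset.sum_congr rfl fun q _ => ?_
  rw [show (if Nat.Coprime q a then f q else 0) = (if Nat.Coprime q a then (1 : ℂ) else 0) * f q by
    split_ifs <;> simp, ite_coprime_eq_sum_moebius, sum_divisors_gcd_eq_sum_filter q ha,
    Finset.sum_filter, Finset.sum_mul]
  refine Finset.sum_congr rfl fun δ _ => ?_
  split_ifs <;> simp

/-- **Möbius inversion in `q₁`**: `pieceSum` over `A₁ ∩ {(q₁,a)=1}` as a signed sum of `pieceSum`s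
over `A₁ ∩ {δ₁ ∣ q₁}`. [cite: Drappeau2017, §5.5 p. 20] -/
theorem pieceSum_filter_coprime_fst (a₁ a₂ : ℤ) (A₁ A₂ B : Finset ℕ) (q₀ n₀ l₁ l₂ : ℕ) (β : ℕ → ℂ)
    (ξ : ℝ) (G : ℕ → ℕ → ℂ) (H : ℕ) {a : ℕ} (ha : a ≠ 0) :
    pieceSum a₁ a₂ (A₁.filter (fun q : ℕ => Nat.Coprime q a)) A₂ B q₀ n₀ l₁ l₂ β ξ G H =
      ∑ δ₁ ∈ a.divisors, (ArithmeticFunction.moebius δ₁ : ℂ) *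
        pieceSum a₁ a₂ (A₁.filter (fun q : ℕ => δ₁ ∣ q)) A₂ B q₀ n₀ l₁ l₂ β ξ G H := by
  unfold pieceSum
  exact sum_filter_coprime_eq_sum_moebius A₁ ha _

/-- Two-level version of `sum_filter_coprime_eq_sum_moebius` (inner variable). [folklore] -/
theorem sum_sum_filter_coprime_eq_sum_moebius (A₁ A₂ : Finset ℕ) {a : ℕ} (ha : a ≠ 0)
    (f : ℕ → ℕ → ℂ) :
    ∑ q₁ ∈ A₁, ∑ q₂ ∈ A₂.filter (fun q : ℕ => Nat.Coprime q a), f q₁ q₂ =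
      ∑ δ ∈ a.divisors, (ArithmeticFunction.moebius δ : ℂ) *
        ∑ q₁ ∈ A₁, ∑ q₂ ∈ A₂.filter (fun q : ℕ => δ ∣ q), f q₁ q₂ := by
  have h1 : ∀ q₁ ∈ A₁, ∑ q₂ ∈ A₂.filter (fun q : ℕ => Nat.Coprime q a), f q₁ q₂ =
      ∑ δ ∈ a.divisors, (ArithmeticFunction.moebius δ : ℂ) *
        ∑ q₂ ∈ A₂.filter (fun q : ℕ => δ ∣ q), f q₁ q₂ :=
    fun q₁ _ => sum_filter_coprime_eq_sum_moebius A₂ ha (f q₁)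
  rw [Finset.sum_congr rfl h1, Finset.sum_comm]
  refine Finset.sum_congr rfl fun δ _ => ?_
  rw [Finset.mul_sum]

/-- **Möbius inversion in `q₂`**. [cite: Drappeau2017, §5.5 p. 20] -/
theorem pieceSum_filter_coprime_snd (a₁ a₂ : ℤ) (A₁ A₂ B : Finset ℕ) (q₀ n₀ l₁ l₂ : ℕ) (β : ℕ → ℂ)
    (ξ : ℝ) (G : ℕ → ℕ → ℂ) (H : ℕ) {a : ℕ} (ha : a ≠ 0) :
    pieceSum a₁ a₂ A₁ (A₂.filter (fun q : ℕ => Nat.Coprime q a)) B q₀ n₀ l₁ l₂ β ξ G H =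
      ∑ δ₂ ∈ a.divisors, (ArithmeticFunction.moebius δ₂ : ℂ) *
        pieceSum a₁ a₂ A₁ (A₂.filter (fun q : ℕ => δ₂ ∣ q)) B q₀ n₀ l₁ l₂ β ξ G H := by
  unfold pieceSum
  exact sum_sum_filter_coprime_eq_sum_moebius A₁ A₂ ha _

/-! ### `ℛ₁''` as a piece sum -/

/-- **`ℛ₁''(A₁,A₂) = pieceSum … G₀`**, `G₀(q₁,q₂) = γ(q₀q₁)γ(q₀q₂)α(q₀q₁q₂ξ/M)` (`γ = BFI.bump S Y`,
`α = BFI.bumpC 1 (1/2)`), provided `q₀q₁q₂ > H` whenever `γ(q₀q₁)γ(q₀q₂) ≠ 0` (then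
`W = [q₀q₁,q₀q₂] = q₀q₁q₂` for the coprime pairs that survive, and `W ∣ h, |h| ≤ H` forces `h = 0`).
[cite: Drappeau2017, §5.5, (5.23)] -/
theorem R1pp_eq_pieceSum (a₁ a₂ : ℤ) (A₁ A₂ B : Finset ℕ) (q₀ n₀ l₁ l₂ : ℕ) (β : ℕ → ℂ)
    (ξ S Y M : ℝ) (H : ℕ)
    (hHW : ∀ q₁ ∈ A₁, ∀ q₂ ∈ A₂, BFI.bump S Y ((q₀ * q₁ : ℕ) : ℝ) ≠ 0 →
      BFI.bump S Y ((q₀ * q₂ : ℕ) : ℝ) ≠ 0 → H < q₀ * q₁ * q₂) :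
    ∑ q₁ ∈ A₁, ∑ q₂ ∈ A₂,
          ((BFI.bump S Y ((q₀ * q₁ : ℕ) : ℝ) : ℝ) : ℂ) * ((BFI.bump S Y ((q₀ * q₂ : ℕ) : ℝ) : ℝ) : ℂ) *
        ∑ n₁ ∈ B, ∑ n₂ ∈ B,
          (if (Nat.Coprime q₁ q₂ ∧ Nat.Coprime n₁ n₂) then (1 : ℂ) else 0) *
            (β (n₀ * n₁) * starRingEnd ℂ (β (n₀ * n₂))) *
          (if ((n₀ * n₁).Coprime (q₀ * q₁) ∧ (n₀ * n₂).Coprime (q₀ * q₂) ∧ n₁ ≡ n₂ [MOD q₀]) then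
              ∑ h ∈ Finset.Icc (-(H : ℤ)) H,
                (if ((Nat.lcm (q₀ * q₁) (q₀ * q₂) : ℕ) : ℤ) ∣ h then 0 else
                  (𝐞 (-(ξ * h)) : ℂ) * BFI.bumpC 1 (1 / 2) ((Nat.lcm (q₀ * q₁) (q₀ * q₂) : ℕ) * ξ / M) *
                    ((𝐞 ((h : ℝ) * a₁ * ((((n₁ : ℤ) - n₂) / q₀ : ℤ)) *
                    ((((((q₁ : ℤ) * a₂ * n₀ * n₂ : ℤ) : ZMod (n₁ * q₂))⁻¹).val : ℕ) : ℝ) /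
                      ((n₁ : ℝ) * q₂)) : ℂ) *
                      (𝐞 (-((h : ℝ) * a₁ *
                    ((((((q₀ : ℤ) * l₁ * l₂ * n₁ : ℤ) : ZMod (a₂.natAbs * n₀))⁻¹).val : ℕ) : ℝ) /
                      ((a₂ : ℝ) * n₀))) : ℂ)))
            else 0) =
      pieceSum a₁ a₂ A₁ A₂ B q₀ n₀ l₁ l₂ β ξ
        (fun q₁ q₂ : ℕ => ((BFI.bump S Y ((q₀ * q₁ : ℕ) : ℝ) : ℝ) : ℂ) * ((BFI.bump S Y ((q₀ * q₂ : ℕ) : ℝ) : ℝ) : ℂ) *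
        BFI.bumpC 1 (1 / 2) (((q₀ * q₁ * q₂ : ℕ) : ℝ) * ξ / M)) H := by
  unfold pieceSum
  refine Finset.sum_congr rfl fun q₁ hq₁ => Finset.sum_congr rfl fun q₂ hq₂ => ?_
  beta_reduce
  by_cases hγ₁ : BFI.bump S Y ((q₀ * q₁ : ℕ) : ℝ) = 0
  · rw [hγ₁]; simp
  by_cases hγ₂ : BFI.bump S Y ((q₀ * q₂ : ℕ) : ℝ) = 0
  · rw [hγ₂]; simp
  have hW := hHW q₁ hq₁ q₂ hq₂ hγ₁ hγ₂
  refine Eq.trans ?_ (mul_assoc _ _ _).symm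
  congr 1
  rw [Finset.mul_sum]
  refine Finset.sum_congr rfl fun n₁ _ => ?_
  rw [Finset.mul_sum]
  refine Finset.sum_congr rfl fun n₂ _ => ?_
  by_cases hcop : (Nat.Coprime q₁ q₂ ∧ Nat.Coprime n₁ n₂)
  swap
  · rw [if_neg hcop]; simp
  rw [if_pos hcop]
  have hlcm : Nat.lcm (q₀ * q₁) (q₀ * q₂) = q₀ * q₁ * q₂ := by
    rw [Nat.lcm_mul_left, hcop.1.lcm_eq_mul, mul_assoc]
  simp only [hlcm]
  split_ifs with hc
  swap
  · simp
  rw [sum_Icc_ite_dvd_eq hW]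
  simp only [Finset.mul_sum]
  refine Finset.sum_congr rfl fun h _ => ?_
  ring
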